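import Summits.Langlands.Langlands.Theorems.TriangulineChamberChamberQpSplit

/-!
# `ChamberQpSplit` (item stmt-Langlands-14533) — the SEEDED shape of the item as filed

Companion to `TriangulineChamberChamberQpSplit.lean` (the seed-free transfer `chamberQpSplit`).
The item as filed reads `IRR''(r̄₁₂, t) ⇒ IRR''(χ̄₁ ⊕ χ̄₂, t)` with the SEEDED chamber statement
(`TriangulineVariety.IrredChamberAt`: at most one irreducible component of type `t`, not contained
in the Borel-valued closure `Z_B`, carrying a regular crystalline Hodge–Tate-regular strictly
dominant `φ`-generic point) on BOTH sides.  The lattice-change charts transport a seed only when it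
lies in the charted locus: for the genuine spaces an irreducible seed transports to either
companion, but a reducible non-ordinary seed — a nonsplit crystalline extension with its
non-critical anti-tautological refinement, Liu–Truong–Xiao–Zhao arXiv:2302.07697 §7.3 case (2b) —
transports only to the companion with the same stable line (through the larger chart `{y ≠ 0}` of
`R^ver = R^ps⟦x, y⟧/(xy - c)` on which `x = c/y`).  The theorems below prove the seeded shape from
the seeded hypothesis under the additional, explicitly displayed input `hdense` — "a seeded
non-ordinary component of type `t` has a seed IN the charted locus" (for the genuine
`X_tri^□(ρ̄)`: an accumulation / Zariski-density statement for irreducible crystalline generic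
points on non-ordinary components, NOT among the item's deps) — together with the transport of the
seed predicates and of non-ordinarity along the charts (isomorphism invariance of "regular /
crystalline / Hodge–Tate regular / strictly dominant / `φ`-generic", and "the slope is read on the
parameter").  The seed-free form needs none of these; see the evidence note
`ChamberQpSplit-proof.md` on the item for the comparison.

## Contents (sorry-free, no definitions)

* `exists_component_over` — along companion charts every irreducible component `C` of `A` meeting
  the charted locus determines a component `C'` of `B` with trace `π_B⁻¹(π_A(C ∩ W_A))`, containing
  every point of `W_B` above a point of `C ∩ W_A`;
* `eq_of_chartTrace_eq` — `C ↦ C'` is injective;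
* `irredChamberAt_of_companionCharts_seeded` — the seeded transfer.

References: as in `TriangulineChamberChamberQpSplit.lean`; Stacks 037A / 004Z (Mathlib
`Mathlib/Topology/Irreducible.lean`).
-/

set_option linter.dupNamespace false -- project-wide option (lakefile weak.linter.dupNamespace); `Summit.Langlands.Langlands` is the mandated namespace

namespace Summit.Langlands.Langlands.Theorems.ChamberQpSplit

open Set Topology TopologicalSpace
open Literature.NumberTheory.GaloisRepresentations

section Charts

variable {A B S : Type*} [TopologicalSpace A] [TopologicalSpace B] [TopologicalSpace S]

/-- **A component over a component.**  In the situation of `subsingleton_components_of_charts`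
(charts `π_A : W_A → S`, `π_B : W_B → S`, continuous open with preirreducible fibres, both onto),
every irreducible component `C` of `A` meeting `W_A` determines an irreducible component `C'` of `B`
whose trace on `W_B` is `π_B⁻¹(π_A(C ∩ W_A))`; in particular every point of `W_B` over a point of
`C ∩ W_A` lies in `C'`. [folklore] -/
theorem exists_component_over {WA : Set A} {WB : Set B} (hWA : IsOpen WA) (hWB : IsOpen WB)
    {πA : WA → S} {πB : WB → S}
    (hAc : Continuous πA) (hAo : IsOpenMap πA) (hAf : ∀ s, IsPreirreducible (πA ⁻¹' {s}))
    (hAs : Function.Surjective πA)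
    (hBc : Continuous πB) (hBo : IsOpenMap πB) (hBf : ∀ s, IsPreirreducible (πB ⁻¹' {s}))
    (hBs : Function.Surjective πB) {C : Set A} (hC : C ∈ irreducibleComponents A)
    (hCW : (C ∩ WA).Nonempty) :
    ∃ C' ∈ irreducibleComponents B,
      ((↑) : WB → B) ⁻¹' C' = πB ⁻¹' (πA '' (((↑) : WA → A) ⁻¹' C)) ∧
        ∀ (a : WA) (b : WB), (a : A) ∈ C → πA a = πB b → (b : B) ∈ C' := by
  have heA : IsOpenEmbedding ((↑) : WA → A) := hWA.isOpenEmbedding_subtypeVal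
  have heB : IsOpenEmbedding ((↑) : WB → B) := hWB.isOpenEmbedding_subtypeVal
  have hD : ((↑) : WA → A) ⁻¹' C ∈ irreducibleComponents WA :=
    preimage_mem_irreducibleComponents hC heA (by rwa [Subtype.range_coe])
  have hZ : πA '' (((↑) : WA → A) ⁻¹' C) ∈ irreducibleComponents S :=
    image_mem_irreducibleComponents_of_isPreirreducible_fiber πA hAc hAo hAf hAs hD
  have hE : πB ⁻¹' (πA '' (((↑) : WA → A) ⁻¹' C)) ∈ irreducibleComponents WB :=
    preimage_mem_irreducibleComponents_of_isPreirreducible_fiber hZ hBc hBo hBf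
      (by rw [hBs.range_eq, inter_univ]; exact hZ.1.nonempty)
  obtain ⟨C', hC', -, hC'E⟩ :=
    Literature.AlgebraicGeometry.Resolution.exists_preimage_eq_of_mem_irreducibleComponents heB hE
  refine ⟨C', hC', hC'E, fun a b haC hab => ?_⟩
  have hbE : b ∈ πB ⁻¹' (πA '' (((↑) : WA → A) ⁻¹' C)) := ⟨a, haC, hab⟩
  have : b ∈ ((↑) : WB → B) ⁻¹' C' := by rw [hC'E]; exact hbE
  exact this

omit [TopologicalSpace B] in
/-- **Injectivity of `C ↦ C'`.**  Two irreducible components of `A` meeting `W_A` with the same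
associated trace `π_B⁻¹(π_A(C ∩ W_A))` on `W_B` are equal (`π_B` onto, `π_A⁻¹(π_A D) = D` for
components `D` of `W_A`, and `C = closure (C ∩ W_A)`). [folklore] -/
theorem eq_of_chartTrace_eq {WA : Set A} {WB : Set B} (hWA : IsOpen WA)
    {πA : WA → S} {πB : WB → S}
    (hAc : Continuous πA) (hAo : IsOpenMap πA) (hAf : ∀ s, IsPreirreducible (πA ⁻¹' {s}))
    (hBs : Function.Surjective πB) {C₁ C₂ : Set A}
    (h₁ : C₁ ∈ irreducibleComponents A) (h₂ : C₂ ∈ irreducibleComponents A)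
    (hne₁ : (C₁ ∩ WA).Nonempty) (hne₂ : (C₂ ∩ WA).Nonempty)
    (h : πB ⁻¹' (πA '' (((↑) : WA → A) ⁻¹' C₁)) = πB ⁻¹' (πA '' (((↑) : WA → A) ⁻¹' C₂))) :
    C₁ = C₂ := by
  have heA : IsOpenEmbedding ((↑) : WA → A) := hWA.isOpenEmbedding_subtypeVal
  have hZZ : πA '' (((↑) : WA → A) ⁻¹' C₁) = πA '' (((↑) : WA → A) ⁻¹' C₂) :=
    hBs.preimage_injective h
  have hD₁ : ((↑) : WA → A) ⁻¹' C₁ ∈ irreducibleComponents WA :=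
    preimage_mem_irreducibleComponents h₁ heA (by rw [Subtype.range_coe]; exact hne₁)
  have hD₂ : ((↑) : WA → A) ⁻¹' C₂ ∈ irreducibleComponents WA :=
    preimage_mem_irreducibleComponents h₂ heA (by rw [Subtype.range_coe]; exact hne₂)
  have hDD : ((↑) : WA → A) ⁻¹' C₁ = ((↑) : WA → A) ⁻¹' C₂ := by
    rw [← preimage_image_eq_of_mem_irreducibleComponents hAc hAo hAf hD₁,
      ← preimage_image_eq_of_mem_irreducibleComponents hAc hAo hAf hD₂, hZZ]
  have htr : C₁ ∩ WA = C₂ ∩ WA := by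
    have h' := congrArg (fun D : Set WA => ((↑) : WA → A) '' D) hDD
    simpa only [image_preimage_eq_inter_range, Subtype.range_coe] using h'
  rw [eq_closure_inter_of_mem_irreducibleComponents h₁ hWA hne₁,
    eq_closure_inter_of_mem_irreducibleComponents h₂ hWA hne₂, htr]

end Charts

section Seeded

variable {K : Type} [Field K] [ValuativeRel K] [TopologicalSpace K] [IsNonarchimedeanLocalField K]
  {p : ℕ} [Fact p.Prime] {O : Type} [CommRing O] [Algebra O (PadicAlgCl p)] {k : Type} [Field k]
  [Algebra O k] [TopologicalSpace k] {n : ℕ} {ρbar ρbar' : ModPGaloisRep K k n}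
  (X : TriangulineVariety K p O k ρbar) (Y : TriangulineVariety K p O k ρbar')
  {S : Type*} [TopologicalSpace S] {WX : Set X.Pt} {WY : Set Y.Pt}
  {πX : WX → S} {πY : WY → S}

/-- **The SEEDED shape of `ChamberQpSplit`** (the item as filed: `IRR''(Y, t) ⇒ IRR''(X, t)` with
seeds on both sides).  Hypotheses: companion charts as in `chamberQpSplit`; `hdense` — a seeded
non-ordinary component of `X` of type `t` has a seed IN THE CHARTED LOCUS `W_X` (density of
irreducible seeds; an extra input); `hseed` — over a common point of the base the seed predicates
pass from `X` to `Y` (isomorphism invariance); `hnonord` — and so does "not in `Z_B`"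
(non-ordinarity is read on the parameter); `hXB : X.BorelLocusClopen d` (the route's
`OrdinaryComponent`, so that a seed of a non-ordinary component is itself outside `Z_B`).  Then the
seeded `Y.IrredChamberAt d 𝔇 t` implies `X.IrredChamberAt d 𝔇 t`. [folklore] -/
theorem irredChamberAt_of_companionCharts_seeded (hWX : IsOpen WX) (hWY : IsOpen WY)
    (hXc : Continuous πX) (hXo : IsOpenMap πX) (hXf : ∀ s, IsPreirreducible (πX ⁻¹' {s}))
    (hXs : Function.Surjective πX)
    (hYc : Continuous πY) (hYo : IsOpenMap πY) (hYf : ∀ s, IsPreirreducible (πY ⁻¹' {s}))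
    (hYs : Function.Surjective πY)
    (hpar : ∀ (x : WX) (y : WY), πX x = πY y → X.torsionType x = Y.torsionType y)
    (d : LocalArtinData K) (𝔇 : PstWeilDeligneData K p)
    (t : Fin n → (CommGroup.torsion Kˣ →* (PadicAlgCl p)ˣ))
    (hdense : ∀ C ∈ irreducibleComponents X.Pt, C ⊆ X.typeStratum t →
      ¬ C ⊆ closure {x | X.IsBorelValuedAt d x} →
      (∃ x ∈ C ∩ X.regular, X.IsCrystallineAt 𝔇 x ∧ X.IsHodgeTateRegularAt 𝔇 x ∧
        X.IsStrictlyDominantAt x ∧ X.IsPhiGenericAt 𝔇 x) →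
      ∃ x : WX, (x : X.Pt) ∈ C ∧ (x : X.Pt) ∈ X.regular ∧ X.IsCrystallineAt 𝔇 x ∧
        X.IsHodgeTateRegularAt 𝔇 x ∧ X.IsStrictlyDominantAt x ∧ X.IsPhiGenericAt 𝔇 x)
    (hseed : ∀ (x : WX) (y : WY), πX x = πY y → (x : X.Pt) ∈ X.regular →
      X.IsCrystallineAt 𝔇 x → X.IsHodgeTateRegularAt 𝔇 x → X.IsStrictlyDominantAt x →
      X.IsPhiGenericAt 𝔇 x →
      (y : Y.Pt) ∈ Y.regular ∧ Y.IsCrystallineAt 𝔇 y ∧ Y.IsHodgeTateRegularAt 𝔇 y ∧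
        Y.IsStrictlyDominantAt y ∧ Y.IsPhiGenericAt 𝔇 y)
    (hnonord : ∀ (x : WX) (y : WY), πX x = πY y →
      (x : X.Pt) ∉ closure {x | X.IsBorelValuedAt d x} →
      (y : Y.Pt) ∉ closure {y | Y.IsBorelValuedAt d y})
    (hXB : X.BorelLocusClopen d)
    (hY : Y.IrredChamberAt d 𝔇 t) : X.IrredChamberAt d 𝔇 t := by
  -- to each admissible component of `X` attach a seeded admissible component of `Y`
  have key : ∀ C ∈ {C ∈ irreducibleComponents X.Pt | C ⊆ X.typeStratum t ∧
      ¬ C ⊆ closure {x | X.IsBorelValuedAt d x} ∧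
      ∃ x ∈ C ∩ X.regular, X.IsCrystallineAt 𝔇 x ∧ X.IsHodgeTateRegularAt 𝔇 x ∧
        X.IsStrictlyDominantAt x ∧ X.IsPhiGenericAt 𝔇 x},
      (C ∩ WX).Nonempty ∧
      ∃ C' ∈ {C' ∈ irreducibleComponents Y.Pt | C' ⊆ Y.typeStratum t ∧
        ¬ C' ⊆ closure {y | Y.IsBorelValuedAt d y} ∧
        ∃ y ∈ C' ∩ Y.regular, Y.IsCrystallineAt 𝔇 y ∧ Y.IsHodgeTateRegularAt 𝔇 y ∧
          Y.IsStrictlyDominantAt y ∧ Y.IsPhiGenericAt 𝔇 y},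
        ((↑) : WY → Y.Pt) ⁻¹' C' = πY ⁻¹' (πX '' (((↑) : WX → X.Pt) ⁻¹' C)) := by
    rintro C ⟨hC, hCt, hCB, hCs⟩
    obtain ⟨x, hxC, hxr, hxc, hxH, hxd, hxφ⟩ := hdense C hC hCt hCB hCs
    have hCW : (C ∩ WX).Nonempty := ⟨x, hxC, x.2⟩
    obtain ⟨C', hC', hC'E, hover⟩ :=
      exists_component_over hWX hWY hXc hXo hXf hXs hYc hYo hYf hYs hC hCW
    obtain ⟨y, hy⟩ := hYs (πX x)
    have hyC' : (y : Y.Pt) ∈ C' := hover x y hxC hy.symm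
    obtain ⟨hyr, hyc, hyH, hyd, hyφ⟩ := hseed x y hy.symm hxr hxc hxH hxd hxφ
    -- the seed `x` lies outside the clopen `Z_B(X)` since `C ⊄ Z_B(X)` (dichotomy)
    have hxB : (x : X.Pt) ∉ closure {x | X.IsBorelValuedAt d x} := fun hxZ =>
      hCB ((X.subset_or_disjoint_of_borelLocusClopen hXB hC).resolve_right
        fun hdis => Set.disjoint_left.mp hdis hxC hxZ)
    have hyB : (y : Y.Pt) ∉ closure {y | Y.IsBorelValuedAt d y} := hnonord x y hy.symm hxB
    refine ⟨hCW, C', ⟨hC', ?_, fun hsub => hyB (hsub hyC'), y, ⟨hyC', hyr⟩, hyc, hyH, hyd, hyφ⟩,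
      hC'E⟩
    -- type: read on the base
    rw [Y.subset_typeStratum_iff_torsionType_eq hC' hyC', ← hpar x y hy.symm]
    exact (X.subset_typeStratum_iff_torsionType_eq hC hxC t).mp hCt
  intro C₁ h₁ C₂ h₂
  obtain ⟨hne₁, C'₁, h'₁, e₁⟩ := key C₁ h₁
  obtain ⟨hne₂, C'₂, h'₂, e₂⟩ := key C₂ h₂
  have hCC : C'₁ = C'₂ := hY h'₁ h'₂
  exact eq_of_chartTrace_eq hWX hXc hXo hXf hYs h₁.1 h₂.1 hne₁ hne₂ (by rw [← e₁, ← e₂, hCC])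

end Seeded

end Summit.Langlands.Langlands.Theorems.ChamberQpSplit
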